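import Summits.ResolutionOfSingularities.ResolutionOfSingularities.Theorems.EquisingularLiftEquisingularLiftNatCarrierDeltaModelFrame
import Summits.ResolutionOfSingularities.ResolutionOfSingularities.Theorems.EquisingularLiftEquisingularLiftNatCarrierDeltaSectionFrameDim
import Summits.ResolutionOfSingularities.ResolutionOfSingularities.Theorems.EquisingularLiftEquisingularLiftNatNDStrataTower
import Literature.AlgebraicGeometry.Resolution.RegularSystemOfParameters
import Literature.AlgebraicGeometry.Resolution.StalkSpecializesLocalization
import Literature.AlgebraicGeometry.Resolution.PrimeDivisorIdeals
import Literature.AlgebraicGeometry.Resolution.SncSaturatedCentre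
import Summits.ResolutionOfSingularities.ResolutionOfSingularities.Theorems.FrobeniusClosingPatchingRelPerfectDepthSNCPointwise
import HarnessLib

/-!
# Crux EL♮(3) `EquisingularLiftNatThree` (stmt-ResolutionOfSingularities-20148), chain W4.5b — DEAL «ND-K5» brick (B3a),
# part 1: THE FRAME LIFT INTO `ker s♯`

[OURS · L1 W4.5b · EL♮(3) stmt-ResolutionOfSingularities-20148 · (B3a) `sncInv_init` part 1 · res-type-027 g19 · helper,
`--supports`; def-free; nothing of the manuscript under review [Hironaka2017] is asserted; AI-written, weaker than expert review]

At K5′'s point step the frame `W` at `x ∈ F₁` (`ND.IsFrameAt W x`: an r.s.p. `w₁, …, wₙ` of `𝒪_{F₁,x}` with `(W_j)_x = (w_j)`)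
is LIFTED through the model square `j : F₁ = X' ×_O k ↪ X'` into the ideal of the section: there are `w̃₁, …, w̃ₙ ∈ 𝒪_{X', j x}`
with `j♯_x w̃_j = w_j`, `(w̃₁, …, w̃ₙ) = (ker s)_{j x}` and `(ϖ, w̃₁, …, w̃ₙ) = 𝔪_{j x}` — an r.s.p. of the `(n+1)`-dimensional
regular local ring `𝒪_{X', j x}` (T-DIM); each `w̃_j` is a prime element.

* `exists_lift_frame` — the local algebra: `π : R ↠ S` local rings, `ker π = (ϖ)`, `𝔠` prime with `𝔠 + (ϖ) = 𝔪_R`, `ϖ ∉ 𝔠`,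
  `(w) = 𝔪_S` ⇒ lifts `w̃ ∈ 𝔠` with `(w̃) = 𝔠` (Nakayama) and `(ϖ, w̃) = 𝔪_R`.
* `exists_frameLift` — the scheme statement at `j x = s(𝔪_O)`.

References (for the mathematics): H. Matsumura, *Commutative Ring Theory* (1986), Thm. 14.2 [Matsumura1987].
-/

set_option linter.dupNamespace false -- mandated namespace `Summit.<Summit>.<Problem>` of this single-conjunct summit
set_option linter.overlappingInstances false -- signatures carry `[IsDomain O] [IsDiscreteValuationRing O]`

noncomputable section

open CategoryTheory AlgebraicGeometry TopologicalSpace IsLocalRing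
open Literature.AlgebraicGeometry.Resolution
open Summit.ResolutionOfSingularities.ResolutionOfSingularities.Theorems (DepthSNC.SNCWithAt)

namespace Summit.ResolutionOfSingularities.ResolutionOfSingularities.Cruxes.EquisingularLiftNat.Sections.ND

/-! ## §1 The local algebra of the lift -/

/-- **Lifting a system of generators of `𝔪_S` along `π : R ↠ S` with `ker π = (ϖ)` into a prime `𝔠` with `𝔠 + (ϖ) = 𝔪_R`,
`ϖ ∉ 𝔠`**: lifts `w̃_j ∈ 𝔠` of the `w_j` with `(w̃) = 𝔠` and `(ϖ, w̃) = 𝔪_R`. [cite: Matsumura1987, Thm. 14.2] -/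
theorem exists_lift_frame {R S : Type*} [CommRing R] [CommRing S] [IsLocalRing R] [IsLocalRing S] [IsNoetherianRing R]
    (π : R →+* S) (hπ : Function.Surjective π) {ϖ : R} (hker : RingHom.ker π = Ideal.span {ϖ})
    (𝔠 : Ideal R) [𝔠.IsPrime] (h𝔠 : 𝔠 ⊔ Ideal.span {ϖ} = maximalIdeal R) (hϖ : ϖ ∉ 𝔠)
    {n : ℕ} (w : Fin n → S) (hw : Ideal.span (Set.range w) = maximalIdeal S) :
    ∃ wt : Fin n → R, (∀ j, π (wt j) = w j) ∧ Ideal.span (Set.range wt) = 𝔠 ∧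
      Ideal.span (Set.range wt) ⊔ Ideal.span {ϖ} = maximalIdeal R := by
  classical
  haveI : IsLocalHom π := IsLocalHom.of_surjective π hπ
  have hϖ𝔪 : ϖ ∈ maximalIdeal R := h𝔠 ▸ Ideal.mem_sup_right (Ideal.mem_span_singleton_self ϖ)
  have hπϖ : π ϖ = 0 := by rw [← RingHom.mem_ker, hker]; exact Ideal.mem_span_singleton_self ϖ
  -- lifts `v_j ∈ 𝔪_R` of the `w_j`, split along `𝔪_R = 𝔠 + (ϖ)`
  have hv : ∀ j, ∃ a ∈ 𝔠, π a = w j := by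
    intro j
    obtain ⟨v, hv⟩ := hπ (w j)
    have hvm : v ∈ maximalIdeal R := by
      rw [mem_maximalIdeal, mem_nonunits_iff]
      intro hu
      have hwu : IsUnit (w j) := hv ▸ hu.map π
      exact (mem_maximalIdeal _ |>.mp (hw ▸ Ideal.subset_span ⟨j, rfl⟩)) hwu
    rw [← h𝔠] at hvm
    obtain ⟨a, ha, b, hb, hab⟩ := Submodule.mem_sup.mp hvm
    obtain ⟨r, rfl⟩ := Ideal.mem_span_singleton'.mp hb
    refine ⟨a, ha, ?_⟩
    rw [← hv, ← hab, map_add, map_mul, hπϖ, mul_zero, add_zero]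
  choose wt hwt𝔠 hπwt using hv
  have hle : Ideal.span (Set.range wt) ≤ 𝔠 := Ideal.span_le.mpr (by rintro _ ⟨j, rfl⟩; exact hwt𝔠 j)
  -- `𝔪_R = (w̃) + (ϖ)`
  have hsup : Ideal.span (Set.range wt) ⊔ Ideal.span {ϖ} = maximalIdeal R := by
    refine le_antisymm (sup_le (hle.trans (h𝔠 ▸ le_sup_left)) ((Ideal.span_singleton_le_iff_mem _).mpr hϖ𝔪)) ?_
    intro m hm
    have hπm : π m ∈ Ideal.map π (Ideal.span (Set.range wt)) := by
      rw [Ideal.map_span, ← Set.range_comp]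
      have : π m ∈ maximalIdeal S := map_nonunit π m hm
      rw [← hw] at this
      convert this using 2
      ext y
      simp only [Set.mem_range, Function.comp_apply, hπwt]
    rw [Ideal.mem_map_iff_of_surjective π hπ] at hπm
    obtain ⟨t, ht, hπt⟩ := hπm
    have hmt : m - t ∈ Ideal.span {ϖ} := by rw [← hker, RingHom.mem_ker, map_sub, hπt, sub_self]
    have : m = t + (m - t) := by ring
    rw [this]
    exact Submodule.add_mem_sup ht hmt
  -- `𝔠 = (w̃)` by Nakayama: `𝔠 ≤ (w̃) + ϖ𝔠 ≤ (w̃) + 𝔪𝔠`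
  have hge : 𝔠 ≤ Ideal.span (Set.range wt) := by
    have h1 : 𝔠 ≤ Ideal.span (Set.range wt) ⊔ maximalIdeal R • 𝔠 := by
      intro c hc
      have hcm : c ∈ maximalIdeal R := h𝔠 ▸ Ideal.mem_sup_left hc
      rw [← hsup] at hcm
      obtain ⟨t, ht, b, hb, htb⟩ := Submodule.mem_sup.mp hcm
      obtain ⟨r, rfl⟩ := Ideal.mem_span_singleton'.mp hb
      have hrϖ : r * ϖ ∈ 𝔠 := by
        have : r * ϖ = c - t := by rw [← htb]; ring
        rw [this]; exact 𝔠.sub_mem hc (hle ht)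
      have hr : r ∈ 𝔠 := (Ideal.IsPrime.mem_or_mem ‹𝔠.IsPrime› hrϖ).resolve_right hϖ
      rw [← htb]
      refine Submodule.add_mem_sup ht ?_
      rw [Ideal.smul_eq_mul, mul_comm]
      exact Ideal.mul_mem_mul hϖ𝔪 hr |> fun h => by simpa [mul_comm] using h
    exact Submodule.le_of_le_smul_of_le_jacobson_bot (IsNoetherian.noetherian 𝔠) (maximalIdeal_le_jacobson _) h1
  exact ⟨wt, hπwt, le_antisymm hle hge, hsup⟩

/-! ## §2 The frame lift at the stepped point `j x = s(𝔪_O)` -/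

/-- Any family generating `(ker s)_p` at the point `p = s(𝔪_O)` of the section, in a regular local ring of dimension `n + 1`, is
quasi-regular (`exists_sectionFrame_of_span_eq`, transported to a point `p` given by an equation). [cite: Matsumura1987, Thm. 16.2] -/
theorem isQuasiRegular_of_span_eq_stalkIdeal_ker (O : Type) [CommRing O] [IsDomain O] [IsDiscreteValuationRing O]
    {X' : Scheme.{0}} (r' : X' ⟶ Spec (.of O)) [IsSeparated r'] (s : Spec (.of O) ⟶ X') (hs : s ≫ r' = 𝟙 _)
    (p : X') (hp : s (IsLocalRing.closedPoint O) = p) (hreg : IsRegularLocalRing (X'.presheaf.stalk p)) {n : ℕ}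
    (wt : Fin n → X'.presheaf.stalk p) (h1 : Ideal.span (Set.range wt) = stalkIdeal s.ker p)
    (hdim : ringKrullDim (X'.presheaf.stalk p) = ((n + 1 : ℕ) : WithBot ℕ∞)) : IsQuasiRegular wt := by
  subst hp
  obtain ⟨ϖ, hϖ⟩ := IsDiscreteValuationRing.exists_irreducible O
  obtain ⟨-, hqr, -⟩ := exists_sectionFrame_of_span_eq O r' s hs hreg ϖ hϖ wt h1 hdim
  exact hqr

/-- **The frame lift.** In K5′'s model square `j : F₁ = X' ×_O k ↪ X'` over the complete DVR `O` (uniformizer `ϖ`), with the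
section `s` through `s(𝔪_O) = j x`, `𝒪_{X',j x}` regular of dimension `n + 1` and a frame `W` at `x` (`ND.IsFrameAt W x`): there are
`w̃₁, …, w̃ₙ ∈ 𝒪_{X',j x}` with `(w̃) = (ker s)_{j x}`, `(w̃) + (ϖ) = 𝔪_{j x}`, `ϖ ∉ (w̃)`, `(W_i)_x = (j♯_x w̃_i)`, the embedding
dimension of `𝒪_{X',j x}` is `n + 1` (so `(ϖ, w̃)` is a regular system of parameters), `𝒪_{X',j x}/(w̃)` is a domain and `w̃` is
quasi-regular. [cite: Matsumura1987, Thm. 14.2] -/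
theorem exists_frameLift (O : Type) [CommRing O] [IsDomain O] [IsDiscreteValuationRing O] (k : Type) [Field k]
    (θ : O →+* k) (hθ : Function.Surjective θ) {X' F₁ : Scheme.{0}} (r' : X' ⟶ Spec (.of O)) [IsSeparated r']
    (s : Spec (.of O) ⟶ X') (hs : s ≫ r' = 𝟙 _) (j : F₁ ⟶ X') (t : F₁ ⟶ Spec (.of k))
    (hsq : IsPullback j t r' (Spec.map (CommRingCat.ofHom θ))) (x : F₁) (hsx : s (IsLocalRing.closedPoint O) = j x)
    (hreg : IsRegularLocalRing (X'.presheaf.stalk (j x))) {n : ℕ}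
    (hdim : ringKrullDim (X'.presheaf.stalk (j x)) = ((n + 1 : ℕ) : WithBot ℕ∞))
    (W : Fin n → F₁.IdealSheafData) (hW : IsFrameAt W x) (ϖ : O) (hϖ : Irreducible ϖ) :
    ∃ wt : Fin n → X'.presheaf.stalk (j x),
      Ideal.span (Set.range wt) = stalkIdeal s.ker (j x) ∧
      Ideal.span (Set.range wt) ⊔
          Ideal.span {(X'.presheaf.Γgerm (j x)).hom (r'.appTop.hom ((Scheme.ΓSpecIso (.of O)).inv.hom ϖ))} =
        maximalIdeal (X'.presheaf.stalk (j x)) ∧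
      (X'.presheaf.Γgerm (j x)).hom (r'.appTop.hom ((Scheme.ΓSpecIso (.of O)).inv.hom ϖ)) ∉ Ideal.span (Set.range wt) ∧
      (∀ i, stalkIdeal (W i) x = Ideal.span {(j.stalkMap x).hom (wt i)}) ∧
      (maximalIdeal (X'.presheaf.stalk (j x))).spanFinrank = n + 1 ∧
      Ideal.span (Set.range (Fin.cons ((X'.presheaf.Γgerm (j x)).hom (r'.appTop.hom ((Scheme.ΓSpecIso (.of O)).inv.hom ϖ))) wt :
          Fin (n + 1) → X'.presheaf.stalk (j x))) = maximalIdeal (X'.presheaf.stalk (j x)) ∧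
      IsDomain (X'.presheaf.stalk (j x) ⧸ Ideal.span (Set.range wt)) ∧ IsQuasiRegular wt ∧
      (∀ 𝔮 : Ideal (X'.presheaf.stalk (j x)), 𝔮.IsPrime → Ideal.span (Set.range wt) ≤ 𝔮 →
        (X'.presheaf.Γgerm (j x)).hom (r'.appTop.hom ((Scheme.ΓSpecIso (.of O)).inv.hom ϖ)) ∉ 𝔮 →
        𝔮 = Ideal.span (Set.range wt)) := by
  haveI := hreg
  set ϖg := (X'.presheaf.Γgerm (j x)).hom (r'.appTop.hom ((Scheme.ΓSpecIso (.of O)).inv.hom ϖ)) with hϖg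
  obtain ⟨n', c, θR, hcI, -, hdom, hθR, h𝔪, hϖc, -⟩ := exists_sectionFrame_forall_dim_at O r' s hs (j x) hsx hreg ϖ hϖ
  obtain ⟨w, hWw, hwspan, -⟩ := hW
  have hϖO : ϖ ∈ maximalIdeal O := by rw [hϖ.maximalIdeal_eq]; exact Ideal.mem_span_singleton_self ϖ
  have hker : RingHom.ker (j.stalkMap x).hom = Ideal.span {ϖg} :=
    le_antisymm (ker_stalkMap_model_le O k θ hθ r' j t hsq x ϖ hϖ)
      ((Ideal.span_singleton_le_iff_mem _).mpr (by
        rw [RingHom.mem_ker]; exact stalkMap_model_varpi θ hθ r' j t hsq x ϖ hϖO))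
  haveI : (Ideal.span (Set.range c)).IsPrime := by
    haveI := hdom
    exact (Ideal.Quotient.isDomain_iff_prime _).mp hdom
  obtain ⟨wt, hπwt, hspan, hsup⟩ := exists_lift_frame (j.stalkMap x).hom (stalkMap_model_surjective θ hθ r' j t hsq x) hker
    (Ideal.span (Set.range c)) h𝔪 hϖc w hwspan
  have hsf : (maximalIdeal (X'.presheaf.stalk (j x))).spanFinrank = n + 1 := by
    have h := (isRegularLocalRing_iff _).mp hreg
    rw [hdim] at h
    exact_mod_cast h
  refine ⟨wt, hspan.trans hcI, hspan.symm ▸ hsup, hspan.symm ▸ hϖc, fun i => by rw [hWw i, hπwt i], hsf, ?_,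
    hspan.symm ▸ hdom, ?_, ?_⟩
  · rw [Fin.range_cons, Ideal.span_insert, sup_comm, hsup]
  · exact isQuasiRegular_of_span_eq_stalkIdeal_ker O r' s hs (j x) hsx hreg wt (hspan.trans hcI) hdim
  · -- the primes of `𝒪/(w̃) ≅ O` are `0` and `𝔪_O ∋ ϖ`
    intro 𝔮 h𝔮 hle hϖ𝔮
    rw [hspan] at hle ⊢
    haveI := h𝔮
    let mk := Ideal.Quotient.mk (Ideal.span (Set.range c))
    haveI h𝔮' : (𝔮.map mk).IsPrime := Ideal.isPrime_map_quotientMk_of_isPrime hle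
    -- transport to `O` along `θR`
    let Q : Ideal O := (𝔮.map mk).comap θR.symm.toRingHom
    haveI hQ : Q.IsPrime := Ideal.IsPrime.comap _
    have hmemQ : ∀ b, b ∈ Q ↔ θR.symm b ∈ 𝔮.map mk := fun b => Ideal.mem_comap
    by_cases hbot : Q = ⊥
    · refine le_antisymm (fun a ha => ?_) hle
      have h1 : θR (mk a) ∈ Q := by
        rw [hmemQ, RingEquiv.symm_apply_apply]; exact Ideal.mem_map_of_mem _ ha
      rw [hbot, Ideal.mem_bot, map_eq_zero_iff _ θR.injective] at h1
      exact Ideal.Quotient.eq_zero_iff_mem.mp h1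
    · exfalso
      obtain ⟨-, P, ⟨hPne, hPprime⟩, hPuniq⟩ := (IsDiscreteValuationRing.iff_pid_with_one_nonzero_prime O).mp ‹_›
      have h1 : Q = P := hPuniq _ ⟨hbot, hQ⟩
      have h2 : maximalIdeal O = P := hPuniq _ ⟨by
        rw [hϖ.maximalIdeal_eq, Ne, Ideal.span_singleton_eq_bot]; exact hϖ.ne_zero, inferInstance⟩
      have hϖmem : ϖ ∈ Q := by
        rw [h1, ← h2, hϖ.maximalIdeal_eq]; exact Ideal.mem_span_singleton_self ϖ
      rw [hmemQ, show θR.symm ϖ = mk ϖg by rw [← hθR ϖ, RingEquiv.symm_apply_apply],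
        Ideal.mem_map_iff_of_surjective _ Ideal.Quotient.mk_surjective] at hϖmem
      obtain ⟨a, ha, hab⟩ := hϖmem
      have : ϖg - a ∈ 𝔮 := hle (Ideal.Quotient.eq.mp hab.symm)
      exact hϖ𝔮 (by simpa using 𝔮.add_mem this ha)

/-! ## §3 Heights of the primes cut out by part of a regular system of parameters -/

/-- **`#S ≤ ht (x_i : i ∈ S)`** for part of a regular system of parameters `x` of a regular local ring (the chain of primes
`(x_{i₁}) ⊂ (x_{i₁}, x_{i₂}) ⊂ ⋯`, Matsumura 14.2/17.8). [cite: Matsumura1987, Thm. 14.2] -/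
theorem card_le_height_span_image_rsop {R : Type*} [CommRing R] [IsRegularLocalRing R] {d : ℕ}
    (hd : (maximalIdeal R).spanFinrank = d) (x : Fin d → R) (hx : Ideal.span (Set.range x) = maximalIdeal R)
    (S : Finset (Fin d)) : (S.card : ℕ∞) ≤ (Ideal.span (x '' (S : Set (Fin d)))).height := by
  classical
  induction S using Finset.induction_on with
  | empty => simp
  | insert a S ha ih =>
    haveI := isPrime_span_image hd x hx S
    haveI := isPrime_span_image hd x hx (insert a S)
    have hlt : Ideal.span (x '' (S : Set (Fin d))) < Ideal.span (x '' ((insert a S : Finset (Fin d)) : Set (Fin d))) := by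
      refine lt_of_le_of_ne (Ideal.span_mono (Set.image_mono (by simp))) fun heq => ?_
      have hmem : x a ∈ Ideal.span (x '' (S : Set (Fin d))) := by
        rw [heq]; exact Ideal.subset_span ⟨a, by simp, rfl⟩
      exact not_mem_span_image_of_not_mem hd x hx (S := (S : Set (Fin d))) (by exact_mod_cast ha) hmem
    calc (((insert a S : Finset (Fin d)).card : ℕ) : ℕ∞) = (S.card : ℕ∞) + 1 := by
          rw [Finset.card_insert_of_notMem ha]; push_cast; rfl
      _ ≤ (Ideal.span (x '' (S : Set (Fin d)))).height + 1 := add_le_add ih le_rfl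
      _ ≤ _ := Ideal.height_add_one_le_of_lt_of_isPrime hlt

/-- **`ht (x_i : i ∈ S) = #S`** for part of a regular system of parameters. [cite: Matsumura1987, Thm. 14.2] -/
theorem height_span_image_rsop {R : Type*} [CommRing R] [IsRegularLocalRing R] {d : ℕ}
    (hd : (maximalIdeal R).spanFinrank = d) (x : Fin d → R) (hx : Ideal.span (Set.range x) = maximalIdeal R)
    (S : Finset (Fin d)) : (Ideal.span (x '' (S : Set (Fin d)))).height = S.card := by
  classical
  refine le_antisymm ?_ (card_le_height_span_image_rsop hd x hx S)
  have hne : Ideal.span (x '' (S : Set (Fin d))) ≠ ⊤ :=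
    ((span_image_le_maximalIdeal x hx _).trans_lt (lt_top_iff_ne_top.mpr (maximalIdeal.isMaximal R).ne_top)).ne
  refine (Ideal.height_le_spanFinrank _ hne).trans ?_
  have hfin : (x '' (S : Set (Fin d))).Finite := (Finset.finite_toSet S).image x
  exact_mod_cast (Submodule.spanFinrank_span_le_ncard_of_finite hfin).trans
    ((Set.ncard_image_le (Finset.finite_toSet S)).trans (by rw [Set.ncard_coe_finset]))

/-- **`ht (x_{σ 1}, …, x_{σ m}) = m`** for an injective selection `σ` of positions of a regular system of parameters.
[cite: Matsumura1987, Thm. 14.2] -/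
theorem height_span_range_comp_rsop {R : Type*} [CommRing R] [IsRegularLocalRing R] {d : ℕ}
    (hd : (maximalIdeal R).spanFinrank = d) (x : Fin d → R) (hx : Ideal.span (Set.range x) = maximalIdeal R)
    {m : ℕ} (σ : Fin m → Fin d) (hσ : Function.Injective σ) :
    (Ideal.span (Set.range (x ∘ σ))).height = m := by
  classical
  have hS : Set.range (x ∘ σ) = x '' ((Finset.univ.image σ : Finset (Fin d)) : Set (Fin d)) := by
    rw [Set.range_comp, Finset.coe_image, Finset.coe_univ, Set.image_univ]
  rw [hS, height_span_image_rsop hd x hx, Finset.card_image_of_injective _ hσ, Finset.card_univ, Fintype.card_fin]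

/-! ## §4 Simple normal crossings with the centre at the two points of the section -/

section SNCAtSection

variable {X : Scheme.{0}} {p : X} {n : ℕ}

/-- **SNC at the closed point of the section.** If `𝒪_{X,p}` is regular with regular system of parameters `v = (v₀, v₁, …, vₙ)`
(`v₀ = ϖ`, `v_{i+1} = w̃_i`), the member `K₀` (the special fibre) has stalk `(v₀)`, the members `W̃_i` have stalks `(v_{i+1})`, and
the centre `C` (the section) has stalk `(v₁, …, vₙ)` at `p`, then `K₀ :: W̃` has simple normal crossings with `C` at `p`.
[cite: BierstoneGrigorievMilmanWlodarczyk2011, Def. 3.1.1 and Def. 3.1.3 (2)] -/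
theorem sncWithAt_cons_of_rsop (hreg : IsRegularLocalRing (X.presheaf.stalk p))
    (v : Fin (n + 1) → X.presheaf.stalk p) (hsf : (maximalIdeal (X.presheaf.stalk p)).spanFinrank = n + 1)
    (hv : Ideal.span (Set.range v) = maximalIdeal (X.presheaf.stalk p))
    (K₀ : X.IdealSheafData) (hK₀ : stalkIdeal K₀ p = Ideal.span {v 0})
    (Wt : Fin n → X.IdealSheafData) (hWt : ∀ i, stalkIdeal (Wt i) p = Ideal.span {v i.succ})
    (C : X.IdealSheafData) (hC : stalkIdeal C p = Ideal.span (Set.range fun i : Fin n => v i.succ)) :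
    DepthSNC.SNCWithAt (K₀ :: List.ofFn Wt) C p := by
  classical
  -- distinct positions have distinct stalks
  have hne : ∀ {a b : Fin (n + 1)}, Ideal.span {v a} = Ideal.span {v b} → a = b := by
    intro a b hab
    by_contra h
    have hmem : v a ∈ Ideal.span (v '' ({b} : Set (Fin (n + 1)))) := by
      rw [Set.image_singleton, ← hab]; exact Ideal.mem_span_singleton_self _
    exact not_mem_span_image_of_not_mem hsf v hv (S := ({b} : Set (Fin (n + 1)))) (by simpa using h) hmem
  -- the position of a member through `p`
  have hpos : ∀ D : {D : X.IdealSheafData // D ∈ K₀ :: List.ofFn Wt ∧ p ∈ D.support},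
      ∃ a : Fin (n + 1), stalkIdeal D.1 p = Ideal.span {v a} := by
    rintro ⟨D, hD, -⟩
    rcases List.mem_cons.mp hD with rfl | hD
    · exact ⟨0, hK₀⟩
    · obtain ⟨i, rfl⟩ := List.mem_ofFn.mp hD
      exact ⟨i.succ, hWt i⟩
  choose ι hι using hpos
  refine ⟨hreg, n + 1, v, hsf, hv, ⟨ι, fun D D' h => ?_, hι⟩, fun _ => ⟨Set.range Fin.succ, by rw [hC, ← Set.range_comp]; rfl⟩⟩
  -- injectivity: equal positions ⇒ equal stalks ⇒ equal members (the list members are told apart by their stalks at `p`)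
  have hst : stalkIdeal D.1 p = stalkIdeal D'.1 p := by rw [hι D, hι D', h]
  rcases D with ⟨D, hD, hDp⟩
  rcases D' with ⟨D', hD', hD'p⟩
  simp only [Subtype.mk.injEq]
  rcases List.mem_cons.mp hD with hD0 | hDt <;> rcases List.mem_cons.mp hD' with hD0' | hDt'
  · rw [hD0, hD0']
  · subst hD0
    obtain ⟨i, rfl⟩ := List.mem_ofFn.mp hDt'
    exact absurd (hne (hK₀.symm.trans (hst.trans (hWt i)))) (Fin.succ_ne_zero i).symm
  · subst hD0'
    obtain ⟨i, rfl⟩ := List.mem_ofFn.mp hDt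
    exact absurd (hne ((hWt i).symm.trans (hst.trans hK₀))) (Fin.succ_ne_zero i)
  · obtain ⟨i, rfl⟩ := List.mem_ofFn.mp hDt
    obtain ⟨i', rfl⟩ := List.mem_ofFn.mp hDt'
    have := hne ((hWt i).symm.trans (hst.trans (hWt i')))
    rw [Fin.succ_inj.mp this]

/-- **SNC at the generic point of the section**, by generisation from the closed point: with the data of
`sncWithAt_cons_of_rsop` at `p`, let `p' ⤳ p` lie on `V(C)` with `𝒪_{X,p'}` regular, `v₀ = ϖ` a unit at `p'`, and suppose the
only prime of `𝒪_{X,p}` containing `(v₁, …, vₙ)` but not `v₀` is `(v₁, …, vₙ)` itself (`𝒪_{X,p}/(v₁, …, vₙ) ≅ O` a DVR). Then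
`𝒪_{X,p'} = (𝒪_{X,p})_{(v₁,…,vₙ)}` has the regular system of parameters `v₁, …, vₙ`, and `K₀ :: W̃` has simple normal crossings with
`C` at `p'` (the fibre `K₀` does not pass through `p'`). [cite: BierstoneGrigorievMilmanWlodarczyk2011, Def. 3.1.1 and Def. 3.1.3 (2)]
[cite: Matsumura1987, Thm. 14.2] -/
theorem sncWithAt_cons_of_rsop_of_specializes (hreg : IsRegularLocalRing (X.presheaf.stalk p))
    (v : Fin (n + 1) → X.presheaf.stalk p) (hsf : (maximalIdeal (X.presheaf.stalk p)).spanFinrank = n + 1)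
    (hv : Ideal.span (Set.range v) = maximalIdeal (X.presheaf.stalk p))
    (K₀ : X.IdealSheafData) (hK₀ : stalkIdeal K₀ p = Ideal.span {v 0})
    (Wt : Fin n → X.IdealSheafData) (hWt : ∀ i, stalkIdeal (Wt i) p = Ideal.span {v i.succ})
    (C : X.IdealSheafData) (hC : stalkIdeal C p = Ideal.span (Set.range fun i : Fin n => v i.succ))
    {p' : X} (h : p' ⤳ p) (hreg' : IsRegularLocalRing (X.presheaf.stalk p')) (hp'C : p' ∈ C.support)
    (hunit : IsUnit ((X.presheaf.stalkSpecializes h).hom (v 0)))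
    (hquot : ∀ 𝔮 : Ideal (X.presheaf.stalk p), 𝔮.IsPrime → Ideal.span (Set.range fun i : Fin n => v i.succ) ≤ 𝔮 →
      v 0 ∉ 𝔮 → 𝔮 = Ideal.span (Set.range fun i : Fin n => v i.succ)) :
    DepthSNC.SNCWithAt (K₀ :: List.ofFn Wt) C p' := by
  classical
  haveI := hreg
  haveI := hreg'
  let φ := (X.presheaf.stalkSpecializes h).hom
  letI := φ.toAlgebra
  set 𝔮₀ : Ideal (X.presheaf.stalk p) := (maximalIdeal (X.presheaf.stalk p')).comap φ with h𝔮₀def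
  haveI : IsLocalization.AtPrime (X.presheaf.stalk p') 𝔮₀ := isLocalizationAtPrime_stalkSpecializes h
  have hφ : ∀ a, algebraMap (X.presheaf.stalk p) (X.presheaf.stalk p') a = φ a := fun _ => rfl
  -- stalks at `p'` are extensions of stalks at `p`
  have hmapC : stalkIdeal C p' = (Ideal.span (Set.range fun i : Fin n => v i.succ)).map φ := by
    rw [← stalkIdeal_map_stalkSpecializes C h, hC]
  have hCne : stalkIdeal C p' ≠ ⊤ := (mem_support_iff_stalkIdeal_ne_top C p').mp hp'C
  -- `𝔮₀ = (v₁, …, vₙ)`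
  have hle : Ideal.span (Set.range fun i : Fin n => v i.succ) ≤ 𝔮₀ := by
    rw [Ideal.span_le]
    rintro _ ⟨i, rfl⟩
    rw [h𝔮₀def, SetLike.mem_coe, Ideal.mem_comap]
    refine le_maximalIdeal hCne ?_
    rw [hmapC]
    exact Ideal.mem_map_of_mem _ (Ideal.subset_span ⟨i, rfl⟩)
  have h0 : v 0 ∉ 𝔮₀ := fun hmem => by
    rw [h𝔮₀def, Ideal.mem_comap] at hmem
    exact (mem_maximalIdeal _).mp hmem hunit
  have h𝔮₀ : 𝔮₀ = Ideal.span (Set.range fun i : Fin n => v i.succ) := hquot 𝔮₀ (Ideal.IsPrime.comap φ) hle h0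
  -- the regular system of parameters at `p'`
  set v' : Fin n → X.presheaf.stalk p' := fun i => φ (v i.succ) with hv'def
  have hv' : Ideal.span (Set.range v') = maximalIdeal (X.presheaf.stalk p') := by
    rw [← IsLocalization.AtPrime.map_eq_maximalIdeal 𝔮₀ (X.presheaf.stalk p'), h𝔮₀, Ideal.map_span, ← Set.range_comp]
    rfl
  have hsf' : (maximalIdeal (X.presheaf.stalk p')).spanFinrank = n := by
    have h1 := (isRegularLocalRing_iff _).mp hreg'
    rw [IsLocalization.AtPrime.ringKrullDim_eq_height 𝔮₀ (X.presheaf.stalk p'), h𝔮₀] at h1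
    have h2 : (Ideal.span (Set.range fun i : Fin n => v i.succ)).height = n :=
      height_span_range_comp_rsop hsf v hv Fin.succ (Fin.succ_injective n)
    rw [h2] at h1
    exact_mod_cast h1
  -- stalks of the members at `p'`
  have hK₀' : stalkIdeal K₀ p' = ⊤ := by
    rw [← stalkIdeal_map_stalkSpecializes K₀ h, hK₀, Ideal.map_span, Set.image_singleton, Ideal.span_singleton_eq_top]
    exact hunit
  have hK₀supp : p' ∉ K₀.support := fun hp => (mem_support_iff_stalkIdeal_ne_top K₀ p').mp hp hK₀'
  have hWt' : ∀ i, stalkIdeal (Wt i) p' = Ideal.span {v' i} := fun i => by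
    rw [← stalkIdeal_map_stalkSpecializes (Wt i) h, hWt i, Ideal.map_span, Set.image_singleton]
  have hne : ∀ {a b : Fin n}, Ideal.span {v' a} = Ideal.span {v' b} → a = b := by
    intro a b hab
    by_contra hab'
    have hmem : v' a ∈ Ideal.span (v' '' ({b} : Set (Fin n))) := by
      rw [Set.image_singleton, ← hab]; exact Ideal.mem_span_singleton_self _
    exact not_mem_span_image_of_not_mem hsf' v' hv' (S := ({b} : Set (Fin n))) (by simpa using hab') hmem
  -- every member through `p'` is some `W̃_i`
  have hpos : ∀ D : {D : X.IdealSheafData // D ∈ K₀ :: List.ofFn Wt ∧ p' ∈ D.support},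
      ∃ i : Fin n, D.1 = Wt i := by
    rintro ⟨D, hD, hDp⟩
    rcases List.mem_cons.mp hD with hD0 | hDt
    · exact absurd hDp (hD0 ▸ hK₀supp)
    · obtain ⟨i, rfl⟩ := List.mem_ofFn.mp hDt
      exact ⟨i, rfl⟩
  choose ι hι using hpos
  refine ⟨hreg', n, v', hsf', hv', ⟨ι, fun D D' hDD' => ?_, fun D => by rw [hι D, hWt']⟩, fun _ => ⟨Set.univ, ?_⟩⟩
  · exact Subtype.ext ((hι D).trans ((congrArg Wt hDD').trans (hι D').symm))
  · rw [hmapC, Ideal.map_span, ← Set.range_comp, Set.image_univ]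
    rfl

end SNCAtSection

end Summit.ResolutionOfSingularities.ResolutionOfSingularities.Cruxes.EquisingularLiftNat.Sections.ND

end
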